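import Summits.FinalStateConjecture.FinalStateConjecture.Theorems.EIHFluxBalanceInertialRecessionStubEndgameBasics

/-!
# Route EIHFluxBalance — crux `InertialRecession`, abstract endgame for general `N`:
# the gapped hierarchy of a finite configuration (laminarity, clear annuli, levers)

Helper file for the crux `stmt-FinalStateConjecture-10166` (virial route, evidence note
`InertialRecession_endgame_generalN_virial.md`, §3; the same geometry is used by the second lead's mechanism (E)). Pure finite metric
geometry of a configuration `ξ : ι → E3` on a finset `s`, stated WITHOUT new definitions: a subset `B ⊆ s` is "`(D, G)`-controlled" when
all its internal distances are `≤ D` and all distances to `s ∖ B` are `≥ G`; it is `Λ`-GAPPED when `Λ·D < G`.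

* `gapped_laminar` — two `Λ`-gapped sets (`Λ ≥ 1`) that meet are nested: the family of gapped sets is LAMINAR (a rooted forest), which is
  what makes "the smallest gapped set containing `B`" a tree parent.
* `exists_clear_annulus` — pigeonhole over geometric scales: around any `j ∈ s`, for any base radius `R₀ > 0` and ratio `q > 1`, some
  annulus `[qᵐR₀, qᵐ⁺¹R₀)`, `m ≤ #s`, contains no other point of the configuration.
* `ball_controlled_of_clear_annulus` — if the annulus `[r, qr)` around `j` is empty then the ball cluster `{i ∈ s : ‖ξᵢ − ξⱼ‖ < r}` is
  `(2r, (q−1)r)`-controlled (hence `Λ`-gapped as soon as `q > 2Λ + 1`): GAPPED CLUSTERS EXIST AT EVERY SCALE.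
* `exists_gapped_ssuperset` / `minimal_gapped_ssuperset_subset_ball` — the LEVER BOUND (H3): a `Λ`-gapped `B` with an outsider
  within `2G` of it has a `Λ`-gapped STRICT superset inside a ball cluster of radius `(4Λ+2)ᵐ·4G`, `m ≤ #s`; by laminarity the minimal
  gapped strict superset of `B` (its tree parent) lies inside that ball, so its diameter is `< 2(4Λ+2)^{#s}·4G` — levers to the
  parent are bounded by a constant times the node's own gap.
-/

noncomputable section

set_option linter.dupNamespace false

open Finset

namespace Summit.FinalStateConjecture.FinalStateConjecture.Theorems.SublinearIsFree.Virial

open Literature.Geometry.Lorentzian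

variable {ι : Type*}

/-! ### Laminarity of gapped sets -/

/-- **Laminarity.** Let `B, B' ⊆ s` with internal distances `≤ D` (resp. `≤ D'`) and external distances (to `s ∖ B`, resp. `s ∖ B'`)
`≥ G` (resp. `≥ G'`), both `Λ`-gapped (`ΛD < G`, `ΛD' < G'`) with `Λ ≥ 1`. If `B ∩ B'` is nonempty then `B ⊆ B'` or `B' ⊆ B`.
(If `x ∈ B ∩ B'`, `y ∈ B ∖ B'`, `z ∈ B' ∖ B` then `d(x,y) ≥ G' > ΛD' ≥ Λd(x,z) ≥ ΛG > Λ²D ≥ Λ²d(x,y)`.) [folklore] -/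
theorem gapped_laminar' [DecidableEq ι] {s B B' : Finset ι} {ξ : ι → E3} {D G D' G' Λ : ℝ} (hΛ : 1 ≤ Λ)
    (hB : B ⊆ s) (hB' : B' ⊆ s)
    (hDB : ∀ x ∈ B, ∀ y ∈ B, ‖ξ x - ξ y‖ ≤ D) (hGB : ∀ x ∈ B, ∀ z ∈ s \ B, G ≤ ‖ξ x - ξ z‖)
    (hDB' : ∀ x ∈ B', ∀ y ∈ B', ‖ξ x - ξ y‖ ≤ D') (hGB' : ∀ x ∈ B', ∀ z ∈ s \ B', G' ≤ ‖ξ x - ξ z‖)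
    (hgap : Λ * D < G) (hgap' : Λ * D' < G') (hmeet : (B ∩ B').Nonempty) :
    B ⊆ B' ∨ B' ⊆ B := by
  by_contra h
  push Not at h
  obtain ⟨h1, h2⟩ := h
  obtain ⟨y, hyB, hyB'⟩ := Finset.not_subset.mp h1
  obtain ⟨z, hzB', hzB⟩ := Finset.not_subset.mp h2
  obtain ⟨x, hx⟩ := hmeet
  rw [Finset.mem_inter] at hx
  have hxy : ‖ξ x - ξ y‖ ≤ D := hDB x hx.1 y hyB
  have hxz : ‖ξ x - ξ z‖ ≤ D' := hDB' x hx.2 z hzB'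
  have hxy' : G' ≤ ‖ξ x - ξ y‖ := hGB' x hx.2 y (Finset.mem_sdiff.mpr ⟨hB hyB, hyB'⟩)
  have hxz' : G ≤ ‖ξ x - ξ z‖ := hGB x hx.1 z (Finset.mem_sdiff.mpr ⟨hB' hzB', hzB⟩)
  have hD0 : 0 ≤ D := (norm_nonneg _).trans hxy
  have hD0' : 0 ≤ D' := (norm_nonneg _).trans hxz
  -- `d(x,y) ≥ G' > ΛD' ≥ Λ d(x,z) ≥ ΛG > Λ²D ≥ Λ² d(x,y) ≥ d(x,y)`
  have h3 : Λ * ‖ξ x - ξ z‖ ≤ Λ * D' := mul_le_mul_of_nonneg_left hxz (by linarith)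
  have h4 : Λ * G ≤ Λ * ‖ξ x - ξ z‖ := mul_le_mul_of_nonneg_left hxz' (by linarith)
  have h5 : Λ * (Λ * D) < Λ * G := mul_lt_mul_of_pos_left hgap (by linarith)
  have h6 : Λ * (Λ * ‖ξ x - ξ y‖) ≤ Λ * (Λ * D) :=
    mul_le_mul_of_nonneg_left (mul_le_mul_of_nonneg_left hxy (by linarith)) (by linarith)
  have h7 : ‖ξ x - ξ y‖ ≤ Λ * (Λ * ‖ξ x - ξ y‖) := by
    have hn := norm_nonneg (ξ x - ξ y)
    nlinarith
  linarith

/-! ### Clear annuli exist (pigeonhole over geometric scales) -/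

/-- **A clear annulus.** For `j ∈ s`, `R₀ > 0`, `q > 1` there is `m ≤ #s` such that no `i ∈ s` has `qᵐR₀ ≤ ‖ξᵢ − ξⱼ‖ < qᵐ⁺¹R₀`:
the `#s` points occupy at most `#s` of the `#s + 1` annuli. [folklore] -/
theorem exists_clear_annulus' (s : Finset ι) (ξ : ι → E3) (j : ι) {R₀ q : ℝ} (hR₀ : 0 < R₀) (hq : 1 < q) :
    ∃ m : ℕ, m ≤ s.card ∧ ∀ i ∈ s, ¬ (q ^ m * R₀ ≤ ‖ξ i - ξ j‖ ∧ ‖ξ i - ξ j‖ < q ^ (m + 1) * R₀) := by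
  classical
  -- the annulus index of a point (as a natural number; points outside every annulus get index `#s + 1`)
  let idx : ι → ℕ := fun i ↦
    if h : ∃ m : ℕ, m ≤ s.card ∧ q ^ m * R₀ ≤ ‖ξ i - ξ j‖ ∧ ‖ξ i - ξ j‖ < q ^ (m + 1) * R₀ then Nat.find h
    else s.card + 1
  -- annulus indices are unique
  have huniq : ∀ i, ∀ m m' : ℕ, q ^ m * R₀ ≤ ‖ξ i - ξ j‖ → ‖ξ i - ξ j‖ < q ^ (m + 1) * R₀ →
      q ^ m' * R₀ ≤ ‖ξ i - ξ j‖ → ‖ξ i - ξ j‖ < q ^ (m' + 1) * R₀ → m = m' := by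
    intro i m m' h1 h2 h3 h4
    have hq0 : 0 < q := by linarith
    by_contra hne
    rcases Nat.lt_or_gt_of_ne hne with hlt | hlt
    · -- `m + 1 ≤ m'`: `q^{m+1} R₀ ≤ q^{m'} R₀ ≤ d < q^{m+1} R₀`
      have : q ^ (m + 1) * R₀ ≤ q ^ m' * R₀ :=
        mul_le_mul_of_nonneg_right (pow_le_pow_right₀ hq.le hlt) hR₀.le
      linarith
    · have : q ^ (m' + 1) * R₀ ≤ q ^ m * R₀ :=
        mul_le_mul_of_nonneg_right (pow_le_pow_right₀ hq.le hlt) hR₀.le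
      linarith
  -- the occupied indices form a set of card ≤ #s inside `range (#s + 2)`; some `m ≤ #s` is free
  have hcard : (s.image idx).card < (Finset.range (s.card + 1)).card := by
    rw [Finset.card_range]
    exact Nat.lt_succ_of_le Finset.card_image_le
  obtain ⟨m, hm, hmfree⟩ := Finset.exists_mem_notMem_of_card_lt_card hcard
  refine ⟨m, Nat.lt_succ_iff.mp (Finset.mem_range.mp hm), fun i hi hann ↦ hmfree ?_⟩
  rw [Finset.mem_image]
  refine ⟨i, hi, ?_⟩
  have hex : ∃ m : ℕ, m ≤ s.card ∧ q ^ m * R₀ ≤ ‖ξ i - ξ j‖ ∧ ‖ξ i - ξ j‖ < q ^ (m + 1) * R₀ :=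
    ⟨m, Nat.lt_succ_iff.mp (Finset.mem_range.mp hm), hann⟩
  simp only [idx, dif_pos hex]
  have hspec := Nat.find_spec hex
  exact huniq i _ _ hspec.2.1 hspec.2.2 hann.1 hann.2

/-! ### Ball clusters below a clear annulus are controlled -/

/-- **Ball clusters.** If no point of `s` lies in the annulus `[r, qr)` around `j` (`r > 0`), then the ball cluster
`B = {i ∈ s : ‖ξᵢ − ξⱼ‖ < r}` has internal distances `< 2r` and external distances `≥ (q − 1)r`; in particular it is `Λ`-gapped
whenever `2Λ + 1 < q`. [folklore] -/
theorem ball_controlled_of_clear_annulus [DecidableEq ι] {s : Finset ι} {ξ : ι → E3} {j : ι} {r q : ℝ}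
    (hclear : ∀ i ∈ s, ¬ (r ≤ ‖ξ i - ξ j‖ ∧ ‖ξ i - ξ j‖ < q * r)) :
    (∀ x ∈ s.filter (fun i ↦ ‖ξ i - ξ j‖ < r), ∀ y ∈ s.filter (fun i ↦ ‖ξ i - ξ j‖ < r), ‖ξ x - ξ y‖ < 2 * r) ∧
      (∀ x ∈ s.filter (fun i ↦ ‖ξ i - ξ j‖ < r), ∀ z ∈ s \ s.filter (fun i ↦ ‖ξ i - ξ j‖ < r),
        (q - 1) * r ≤ ‖ξ x - ξ z‖) := by
  constructor
  · intro x hx y hy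
    rw [Finset.mem_filter] at hx hy
    calc ‖ξ x - ξ y‖ = ‖(ξ x - ξ j) - (ξ y - ξ j)‖ := by rw [sub_sub_sub_cancel_right]
      _ ≤ ‖ξ x - ξ j‖ + ‖ξ y - ξ j‖ := norm_sub_le _ _
      _ < 2 * r := by linarith [hx.2, hy.2]
  · intro x hx z hz
    rw [Finset.mem_filter] at hx
    rw [Finset.mem_sdiff, Finset.mem_filter] at hz
    have hzs : z ∈ s := hz.1
    have hzr : r ≤ ‖ξ z - ξ j‖ := by
      by_contra h
      push Not at h
      exact hz.2 ⟨hzs, h⟩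
    have hzq : q * r ≤ ‖ξ z - ξ j‖ := by
      by_contra h
      push Not at h
      exact hclear z hzs ⟨hzr, h⟩
    calc (q - 1) * r = q * r - r := by ring
      _ ≤ ‖ξ z - ξ j‖ - ‖ξ x - ξ j‖ := by linarith [hx.2]
      _ ≤ ‖(ξ z - ξ j) - (ξ x - ξ j)‖ := norm_sub_norm_le _ _
      _ = ‖ξ x - ξ z‖ := by rw [sub_sub_sub_cancel_right, norm_sub_rev]

/-! ### The lever bound: a gapped set has a gapped strict superset of comparable size -/

/-- **A gapped strict superset of controlled size.** Let `B ⊆ s` be `(D, G)`-controlled and `Λ`-gapped (`ΛD < G`, `Λ ≥ 1`, `G > 0`),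
`j ∈ B`, and let some outsider be within `2G` of `B` (true when `G` is at least half the actual gap). Put `q := 4Λ + 2`. Then for
some `m ≤ #s` the ball cluster of radius `r = qᵐ·4G` around `j` strictly contains `B`, has internal distances `< 2r` and external
distances `≥ (4Λ+1)r > Λ·(2r)`: a `Λ`-gapped strict superset of `B` of diameter `< 2(4Λ+2)^{#s}·4G`. [folklore] -/
theorem exists_gapped_ssuperset [DecidableEq ι] {s B : Finset ι} {ξ : ι → E3} {D G Λ : ℝ} (hΛ : 1 ≤ Λ)
    (hB : B ⊆ s) {j : ι} (hj : j ∈ B)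
    (hDB : ∀ x ∈ B, ∀ y ∈ B, ‖ξ x - ξ y‖ ≤ D)
    (hG : 0 < G) (hgap : Λ * D < G)
    (hnear : ∃ x₀ ∈ B, ∃ z₀ ∈ s \ B, ‖ξ x₀ - ξ z₀‖ < 2 * G) :
    ∃ m : ℕ, m ≤ s.card ∧
      B ⊆ s.filter (fun i ↦ ‖ξ i - ξ j‖ < (4 * Λ + 2) ^ m * (4 * G)) ∧
      ¬ (s.filter (fun i ↦ ‖ξ i - ξ j‖ < (4 * Λ + 2) ^ m * (4 * G)) ⊆ B) ∧
      (∀ x ∈ s.filter (fun i ↦ ‖ξ i - ξ j‖ < (4 * Λ + 2) ^ m * (4 * G)),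
        ∀ y ∈ s.filter (fun i ↦ ‖ξ i - ξ j‖ < (4 * Λ + 2) ^ m * (4 * G)),
          ‖ξ x - ξ y‖ < 2 * ((4 * Λ + 2) ^ m * (4 * G))) ∧
      (∀ x ∈ s.filter (fun i ↦ ‖ξ i - ξ j‖ < (4 * Λ + 2) ^ m * (4 * G)),
        ∀ z ∈ s \ s.filter (fun i ↦ ‖ξ i - ξ j‖ < (4 * Λ + 2) ^ m * (4 * G)),
          (4 * Λ + 1) * ((4 * Λ + 2) ^ m * (4 * G)) ≤ ‖ξ x - ξ z‖) := by
  set q : ℝ := 4 * Λ + 2 with hq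
  have hq1 : 1 < q := by rw [hq]; linarith
  have hR₀ : 0 < 4 * G := by linarith
  obtain ⟨m, hm, hclear⟩ := exists_clear_annulus' s ξ j hR₀ hq1
  set r : ℝ := q ^ m * (4 * G) with hr
  have hqm : (1 : ℝ) ≤ q ^ m := one_le_pow₀ hq1.le
  have hrG : 4 * G ≤ r := by rw [hr]; nlinarith
  have hr0 : 0 < r := by linarith
  have hqr : q * r = q ^ (m + 1) * (4 * G) := by rw [hr]; ring
  have hclear' : ∀ i ∈ s, ¬ (r ≤ ‖ξ i - ξ j‖ ∧ ‖ξ i - ξ j‖ < q * r) := fun i hi h ↦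
    hclear i hi (by rwa [hqr] at h)
  obtain ⟨hint, hext⟩ := ball_controlled_of_clear_annulus (s := s) (ξ := ξ) (j := j) (r := r) (q := q) hclear'
  have hD0 : 0 ≤ D := (norm_nonneg _).trans (hDB j hj j hj)
  have hD : D < G := by nlinarith
  refine ⟨m, hm, ?_, ?_, hint, ?_⟩
  · -- `B ⊆ ball`: internal distances `≤ D < G ≤ r`
    intro x hx
    rw [Finset.mem_filter]
    exact ⟨hB hx, by linarith [hDB x hx j hj]⟩
  · -- the near outsider `z₀` is in the ball but not in `B`
    obtain ⟨x₀, hx₀, z₀, hz₀, hnear'⟩ := hnear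
    intro hsub
    have hz₀s : z₀ ∈ s := (Finset.mem_sdiff.mp hz₀).1
    have hz₀B : z₀ ∉ B := (Finset.mem_sdiff.mp hz₀).2
    have hz₀ball : z₀ ∈ s.filter (fun i ↦ ‖ξ i - ξ j‖ < r) := by
      rw [Finset.mem_filter]
      refine ⟨hz₀s, ?_⟩
      calc ‖ξ z₀ - ξ j‖ = ‖(ξ z₀ - ξ x₀) + (ξ x₀ - ξ j)‖ := by rw [sub_add_sub_cancel]
        _ ≤ ‖ξ z₀ - ξ x₀‖ + ‖ξ x₀ - ξ j‖ := norm_add_le _ _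
        _ < 2 * G + D := by rw [norm_sub_rev]; linarith [hDB x₀ hx₀ j hj]
        _ < r := by linarith
    exact hz₀B (hsub hz₀ball)
  · intro x hx z hz
    have h := hext x hx z hz
    have hq' : (4 * Λ + 1) * r = (q - 1) * r := by rw [hq]; ring
    linarith

/-- **The lever bound (H3).** With the data of `exists_gapped_ssuperset`, every MINIMAL `Λ`-gapped strict superset `B'` of `B`
(controlled by some `(D', G')` with `ΛD' < G'`, and such that no `Λ`-gapped `B''` satisfies `B ⊊ B'' ⊊ B'`) is contained in that
ball cluster; in particular its internal distances are `< 2(4Λ+2)^{#s}·4G`. (Laminarity: the ball meets `B'` in `B`; if the ball were a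
strict subset of `B'` minimality would fail, so `B' ⊆` ball.) [folklore] -/
theorem minimal_gapped_ssuperset_subset_ball [DecidableEq ι] {s B B' : Finset ι} {ξ : ι → E3} {D G D' G' Λ : ℝ} (hΛ : 1 ≤ Λ)
    (hB : B ⊆ s) (hBne : B.Nonempty) {j : ι} (hj : j ∈ B)
    (hDB : ∀ x ∈ B, ∀ y ∈ B, ‖ξ x - ξ y‖ ≤ D)
    (hG : 0 < G) (hgap : Λ * D < G)
    (hnear : ∃ x₀ ∈ B, ∃ z₀ ∈ s \ B, ‖ξ x₀ - ξ z₀‖ < 2 * G)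
    (hB' : B' ⊆ s) (hBB' : B ⊆ B')
    (hDB' : ∀ x ∈ B', ∀ y ∈ B', ‖ξ x - ξ y‖ ≤ D') (hGB' : ∀ x ∈ B', ∀ z ∈ s \ B', G' ≤ ‖ξ x - ξ z‖)
    (hgap' : Λ * D' < G')
    (hmin : ∀ B'' : Finset ι, B ⊆ B'' → B'' ⊆ B' → ¬ (B'' ⊆ B) →
      (∃ D'' G'' : ℝ, (∀ x ∈ B'', ∀ y ∈ B'', ‖ξ x - ξ y‖ ≤ D'') ∧ (∀ x ∈ B'', ∀ z ∈ s \ B'', G'' ≤ ‖ξ x - ξ z‖) ∧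
        Λ * D'' < G'') → B' ⊆ B'') :
    ∃ m : ℕ, m ≤ s.card ∧ B' ⊆ s.filter (fun i ↦ ‖ξ i - ξ j‖ < (4 * Λ + 2) ^ m * (4 * G)) ∧
      ∀ x ∈ B', ∀ y ∈ B', ‖ξ x - ξ y‖ < 2 * ((4 * Λ + 2) ^ s.card * (4 * G)) := by
  obtain ⟨m, hm, hsub, hnot, hint, hext⟩ := exists_gapped_ssuperset hΛ hB hj hDB hG hgap hnear
  set r : ℝ := (4 * Λ + 2) ^ m * (4 * G) with hr
  have hr0 : 0 < r := by positivity
  have hballs : s.filter (fun i ↦ ‖ξ i - ξ j‖ < r) ⊆ s := Finset.filter_subset _ _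
  -- laminarity between `B'` and the ball (both `Λ`-gapped, both contain `B`)
  have hlam := gapped_laminar' (s := s) (B := B') (B' := s.filter (fun i ↦ ‖ξ i - ξ j‖ < r)) (ξ := ξ) (D := D')
    (G := G') (D' := 2 * r) (G' := (4 * Λ + 1) * r) (Λ := Λ) hΛ hB' hballs hDB' hGB'
    (fun x hx y hy ↦ (hint x hx y hy).le) hext hgap' (by nlinarith)
    (by
      obtain ⟨x, hx⟩ := hBne
      exact ⟨x, Finset.mem_inter.mpr ⟨hBB' hx, hsub hx⟩⟩)
  have hB'ball : B' ⊆ s.filter (fun i ↦ ‖ξ i - ξ j‖ < r) := by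
    rcases hlam with h | h
    · exact h
    · exact hmin _ hsub h hnot ⟨2 * r, (4 * Λ + 1) * r, fun x hx y hy ↦ (hint x hx y hy).le, hext, by nlinarith⟩
  refine ⟨m, hm, hB'ball, fun x hx y hy ↦ ?_⟩
  have h1 := hint x (hB'ball hx) y (hB'ball hy)
  have hpow : (4 * Λ + 2) ^ m ≤ (4 * Λ + 2) ^ s.card := pow_le_pow_right₀ (by linarith) hm
  have : r ≤ (4 * Λ + 2) ^ s.card * (4 * G) := by
    rw [hr]; exact mul_le_mul_of_nonneg_right hpow (by linarith)
  linarith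

/-! ### Registered stubs (one-line signatures, verbatim) -/

/-- Registered stub `gapped_laminar` (crux `stmt-FinalStateConjecture-10166`): gapped sets form a laminar family, one-line form of
`gapped_laminar'`. [folklore] -/
theorem gapped_laminar : open Literature.Geometry.Lorentzian in ∀ {ι : Type*} [DecidableEq ι] {s B B' : Finset ι} {ξ : ι → E3} {D G D' G' Λ : ℝ}, 1 ≤ Λ → B ⊆ s → B' ⊆ s → (∀ x ∈ B, ∀ y ∈ B, ‖ξ x - ξ y‖ ≤ D) → (∀ x ∈ B, ∀ z ∈ s \ B, G ≤ ‖ξ x - ξ z‖) → (∀ x ∈ B', ∀ y ∈ B', ‖ξ x - ξ y‖ ≤ D') → (∀ x ∈ B', ∀ z ∈ s \ B', G' ≤ ‖ξ x - ξ z‖) → Λ * D < G → Λ * D' < G' → (B ∩ B').Nonempty → B ⊆ B' ∨ B' ⊆ B :=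
  fun hΛ hB hB' hDB hGB hDB' hGB' hgap hgap' hmeet ↦ gapped_laminar' hΛ hB hB' hDB hGB hDB' hGB' hgap hgap' hmeet

/-- Registered stub `exists_clear_annulus` (crux `stmt-FinalStateConjecture-10166`): a clear geometric annulus around any point of a
finite configuration, one-line form of `exists_clear_annulus'`. [folklore] -/
theorem exists_clear_annulus : open Literature.Geometry.Lorentzian in ∀ {ι : Type*} (s : Finset ι) (ξ : ι → E3) (j : ι) {R₀ q : ℝ}, 0 < R₀ → 1 < q → ∃ m : ℕ, m ≤ s.card ∧ ∀ i ∈ s, ¬ (q ^ m * R₀ ≤ ‖ξ i - ξ j‖ ∧ ‖ξ i - ξ j‖ < q ^ (m + 1) * R₀) :=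
  fun s ξ j _ _ hR₀ hq ↦ exists_clear_annulus' s ξ j hR₀ hq

end Summit.FinalStateConjecture.FinalStateConjecture.Theorems.SublinearIsFree.Virial

end
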